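import Summits.Ventures.YMGap.RobustBall.RobustSlabSteps
import HarnessLib

/-!
# Robust ball (Y2), area-law side, part 2c — the SPARSE PEELING induction for perturbed actions

HONEST FRAMING: venture file of the cell `pub-ymgap` (QuantumFields programme), track ROBUST-BALL. Strong-coupling, finite-torus
bookkeeping for a PERTURBED Wilson weight `exp(-Nβ S_W - W)`, `W` bounded measurable (parts 1a/1b: `RobustSlabLaw`,
`RobustSlabDisintegration`).  No area law is concluded in this file (that is `RobustSlabCriterion`); no continuum / mass-gap / Clay
claim anywhere on this track.

§Peeling (the induction): the Cao–Nissim–Sheffield induction `norm_integral_loopObs_le` generalised to the perturbed weight with a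
VERTICAL RANGE `m ≥ 1` (`hloc : HasVerticalRange W v m`).  From the top of the loop down, every `m`-th slab is INTEGRATED (factor `N²ε`,
`ε` the perturbed-slab two-point bound at the leg positions, uniform in the height and in the off-slab links) and the `m-1`
vertical links in between are ABSORBED into the bounded matrix factor (factor `N²` each; no smallness and no locality needed); by
(HLoc) the integrated factor never sees a lower slab that will be integrated.  Result:
`‖∫ e^{-NβS-W} tr(A·leg_s·B·leg_s^*)‖ ≤ N²K · peelBound a s · ∫ e^{-NβS-W}`, `peelBound 0 T = N^{2T} ε^{⌈T/m⌉}`.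
At `m = 1`, `W = 0` this is the tree's induction verbatim.

References: Cao–Nissim–Sheffield arXiv:2509.04688v2 §2 (proof of Thm. 2.3); Durhuus–Fröhlich CMP 75 (1980) Thms. 1.2–1.3.
-/

noncomputable section

open MeasureTheory
open Literature.MathematicalPhysics.QuantumLattice (fundamentalRep continuous_fundamentalRep fundamentalRep_apply)
open Literature.MathematicalPhysics.QuantumFieldTheory
open Literature.MathematicalPhysics.QuantumFieldTheory.DurhuusFrohlich

namespace Summit.Ventures.YMGap.RobustBall

variable {n L N : ℕ}

/-! ### The sparse peeling induction -/

section Peeling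

variable [NeZero L] {W : GaugeConfig (n + 1) L (SU N) → ℝ}


/-- **THE SPARSE PEELING INDUCTION** (robust version of the Cao–Nissim–Sheffield induction). Let `W` be bounded measurable with
vertical range `m ≥ 1` seen by the `v`-slabs (`hloc`), and suppose every perturbed-slab two-point function at the leg positions
`p, p'` is bounded by `ε`, uniformly in the height and the off-slab links (`hε`).  Then for every number `s` of remaining legs
with `2s ≤ L`, every counter `a < m` («absorptions before the next integration»), horizontal `A` (entries ≤ 1) and `B` with
entries `≤ K` not seeing the vertical links at the heights `t₀, …, t₀ + (s - a) - 1`: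
`‖∫ e^{-NβS-W} tr(A·leg_s(p)·B·leg_s(p')^*)‖ ≤ N² K · peelBound a s · ∫ e^{-NβS-W}`,
`peelBound 0 T = N^{2T} ε^{⌈T/m⌉}`. [cite: CaoNissimSheffield2025dynamical, §2] -/
theorem norm_integral_loopObs_le_W (v : Fin (n + 1)) (t₀ : ZMod L) (p p' : Site n L) (β : ℝ)
    (hWm : Measurable W) (hWb : ∃ C, ∀ U, |W U| ≤ C) {m : ℕ} (hm : 1 ≤ m) (hloc : HasVerticalRange W v m)
    {ε : ℝ} (hε0 : 0 ≤ ε)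
    (hε : ∀ (t : ZMod L) (r : {e : Edge (n + 1) L // ¬ IsSlab v t e} → SU N) (a b c d : Fin N),
      ‖∫ Q, ((Q p : SU N) : Matrix (Fin N) (Fin N) ℂ) a b * (((Q p')⁻¹ : SU N) : Matrix (Fin N) (Fin N) ℂ) c d
        ∂(slabLawW v t β W r)‖ ≤ ε) :
    ∀ (s : ℕ), 2 * s ≤ L → ∀ (a : ℕ), a < m → ∀ (K : ℝ), 0 ≤ K →
      ∀ (A B : GaugeConfig (n + 1) L (SU N) → Matrix (Fin N) (Fin N) ℂ),
      (∀ a b, Measurable fun U => A U a b) → (∀ a b, Measurable fun U => B U a b) →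
      (∀ U a b, ‖A U a b‖ ≤ 1) → (∀ U a b, ‖B U a b‖ ≤ K) → IsHorizontal v A → SeesOnlyAbove v t₀ (s - a) B →
      ‖∫ U, (weightW N β W U : ℂ) * loopObs v t₀ p p' s A B U ∂(linkMeasure n L N)‖ ≤
        (N : ℝ) ^ 2 * K * peelBound N m ε a s * ∫ U, weightW N β W U ∂(linkMeasure n L N) := by
  intro s
  induction s with
  | zero =>
    intro _ a _ K hK A B hAm hBm hA hB _ _
    have hpb : peelBound N m ε a 0 = 1 := by cases a <;> rfl
    rw [hpb, mul_one]
    have hbound : ∀ U, ‖loopObs v t₀ p p' 0 A B U‖ ≤ (N : ℝ) ^ 2 * K := by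
      intro U
      simp only [loopObs, leg, Submonoid.coe_one, star_one, mul_one]
      rw [Matrix.trace]
      calc ‖∑ a, (A U * B U) a a‖ ≤ ∑ a, ‖(A U * B U) a a‖ := norm_sum_le _ _
        _ ≤ ∑ _a : Fin N, (N : ℝ) * (1 * K) := Finset.sum_le_sum fun a _ => norm_mul_entry_le' (hA U) (hB U) a a
        _ = (N : ℝ) ^ 2 * K := by simp; ring
    have hm' : Measurable (loopObs v t₀ p p' 0 A B) := measurable_loopObs v t₀ p p' 0 hAm hBm
    calc ‖∫ U, (weightW N β W U : ℂ) * loopObs v t₀ p p' 0 A B U ∂(linkMeasure n L N)‖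
        ≤ ∫ U, ‖(weightW N β W U : ℂ) * loopObs v t₀ p p' 0 A B U‖ ∂(linkMeasure n L N) :=
          norm_integral_le_integral_norm _
      _ ≤ ∫ U, weightW N β W U * ((N : ℝ) ^ 2 * K) ∂(linkMeasure n L N) := by
          refine integral_mono (integrable_weightW_mul β hWm hWb hm' hbound).norm ?_ fun U => ?_
          · exact (integrable_weightW β hWm hWb).mul_const _
          · rw [norm_mul, Complex.norm_real, Real.norm_eq_abs, abs_of_pos (weightW_pos W β U)]
            exact mul_le_mul_of_nonneg_left (hbound U) (weightW_pos W β U).le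
      _ = (N : ℝ) ^ 2 * K * ∫ U, weightW N β W U ∂(linkMeasure n L N) := by
          rw [integral_mul_const, mul_comm]
  | succ s ih =>
    intro h2s a ha K hK A B hAm hBm hA hB hAh hBs
    have hsL : s < L := by omega
    have h2s' : 2 * s ≤ L := by omega
    cases a with
    | succ a =>
      /- ABSORB the top vertical links (height `t₀ + s`) into `B`. -/
      have hpt : (fun U => (weightW N β W U : ℂ) * loopObs v t₀ p p' (s + 1) A B U) =
          fun U => (weightW N β W U : ℂ) * loopObs v t₀ p p' s A (absorbB v t₀ p p' s B) U := by
        funext U; rw [loopObs_succ_eq_absorbB]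
      have hB'm : ∀ a b, Measurable fun U => absorbB v t₀ p p' s B U a b := fun a b =>
        measurable_mul_entry' (measurable_mul_entry' (measurable_vlink_entry' v t₀ p s) hBm)
          (measurable_star_vlink_entry' v t₀ p' s) a b
      have hB'b : ∀ U a b, ‖absorbB v t₀ p p' s B U a b‖ ≤ (N : ℝ) ^ 2 * K := by
        intro U a b
        have h := norm_mul_entry_le' (norm_mul_entry_le' (fun a b => norm_entry_le (vlink v t₀ p s U) a b) (hB U))
          (fun a b => norm_star_entry_le' (vlink v t₀ p' s U) a b) a b
        calc _ ≤ (N : ℝ) * ((N : ℝ) * (1 * K) * 1) := h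
          _ = (N : ℝ) ^ 2 * K := by ring
      have hB's : SeesOnlyAbove v t₀ (s - a) (absorbB v t₀ p p' s B) := by
        intro U U' hUU'
        have hsa : s + 1 - (a + 1) = s - a := by omega
        rw [hsa] at hBs
        have hBUU' : B U = B U' := hBs U U' hUU'
        have hv : ∀ q : Site n L, U (ins v (t₀ + (s : ZMod L)) q, v) = U' (ins v (t₀ + (s : ZMod L)) q, v) := by
          intro q
          refine hUU' _ ?_
          rintro ⟨k, hk, -, hke⟩
          have hke' : t₀ + (s : ZMod L) = t₀ + (k : ZMod L) := by simpa [ins] using hke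
          have := Literature.MathematicalPhysics.QuantumLattice.nat_eq_of_zmod_cast_eq hsL (by omega) (add_left_cancel hke')
          omega
        simp only [absorbB, vlink, hv, hBUU']
      rw [hpt]
      calc _ ≤ (N : ℝ) ^ 2 * ((N : ℝ) ^ 2 * K) * peelBound N m ε a s * ∫ U, weightW N β W U ∂(linkMeasure n L N) :=
            ih h2s' a (by omega) _ (by positivity) A _ hAm hB'm hA hB'b hAh hB's
        _ = (N : ℝ) ^ 2 * K * peelBound N m ε (a + 1) (s + 1) * ∫ U, weightW N β W U ∂(linkMeasure n L N) := by
            rw [peelBound]; ring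
    | zero =>
      /- INTEGRATE the top slab (height `t₀ + s`). -/
      rw [Nat.sub_zero] at hBs
      have hGslab : ∀ τ Q r, legFactor v t₀ p p' s A τ (glue v (t₀ + (s : ZMod L)) Q r) =
          legFactor v t₀ p p' s A τ (glue v (t₀ + (s : ZMod L)) (fun _ => 1) r) := by
        intro τ Q r
        simp only [legFactor]
        rw [leg_glue' v t₀ p hsL Q (fun _ => 1) r, leg_glue' v t₀ p' hsL Q (fun _ => 1) r,
          hAh (glue v (t₀ + (s : ZMod L)) Q r) (glue v (t₀ + (s : ZMod L)) (fun _ => 1) r) fun e he => ?_]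
        have hns : ¬ IsSlab v (t₀ + (s : ZMod L)) e := fun h => he h.1
        rw [glue_of_not_isSlab _ _ _ _ hns, glue_of_not_isSlab _ _ _ _ hns]
      -- `B` is constant on the slab being integrated
      have hBc : ∀ Q r, B (glue v (t₀ + (s : ZMod L)) Q r) = B (glue v (t₀ + (s : ZMod L)) (fun _ => 1) r) := by
        intro Q r
        refine hBs _ _ fun e he => ?_
        have hns : ¬ IsSlab v (t₀ + (s : ZMod L)) e := fun h => he ⟨s, Nat.lt_succ_self s, h⟩
        rw [glue_of_not_isSlab _ _ _ _ hns, glue_of_not_isSlab _ _ _ _ hns]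
      -- Step 1: expand, peel the top slab in every term, recombine
      have hstep : ∫ U, (weightW N β W U : ℂ) * loopObs v t₀ p p' (s + 1) A B U ∂(linkMeasure n L N) =
          ∫ U, (weightW N β W U : ℂ) * loopObs v t₀ p p' s A (peelBW v t₀ p p' s β W B) U ∂(linkMeasure n L N) := by
        have e1 : (fun U => (weightW N β W U : ℂ) * loopObs v t₀ p p' (s + 1) A B U) = fun U =>
            ∑ τ : Fin N × Fin N × Fin N, (weightW N β W U : ℂ) *
              (legFactor v t₀ p p' s A τ U * slabFactor v t₀ p p' s B (τ.2.1, τ.2.2) U) := by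
          funext U; rw [loopObs_succ', Finset.mul_sum]
        have e2 : (fun U => (weightW N β W U : ℂ) * loopObs v t₀ p p' s A (peelBW v t₀ p p' s β W B) U) = fun U =>
            ∑ τ : Fin N × Fin N × Fin N, (weightW N β W U : ℂ) *
              (legFactor v t₀ p p' s A τ U * slabAvgW v (t₀ + (s : ZMod L)) β W
                (slabFactor v t₀ p p' s B (τ.2.1, τ.2.2)) (restPart v (t₀ + (s : ZMod L)) U)) := by
          funext U; rw [loopObs_eq_sum', Finset.mul_sum]; simp only [peelBW_apply]
        have i1 : ∀ τ : Fin N × Fin N × Fin N, Integrable (fun U => (weightW N β W U : ℂ) *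
            (legFactor v t₀ p p' s A τ U * slabFactor v t₀ p p' s B (τ.2.1, τ.2.2) U)) (linkMeasure n L N) :=
          fun τ => integrable_weightW_mul β hWm hWb ((measurable_legFactor' v t₀ p p' s hAm τ).mul
            (measurable_slabFactor' v t₀ p p' s hBm _)) fun U => by
            rw [norm_mul]
            exact mul_le_mul (norm_legFactor_le' v t₀ p p' s hA τ U) (norm_slabFactor_le' v t₀ p p' s hB _ U)
              (norm_nonneg _) (Nat.cast_nonneg _)
        have i2 : ∀ τ : Fin N × Fin N × Fin N, Integrable (fun U => (weightW N β W U : ℂ) *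
            (legFactor v t₀ p p' s A τ U * slabAvgW v (t₀ + (s : ZMod L)) β W
              (slabFactor v t₀ p p' s B (τ.2.1, τ.2.2)) (restPart v (t₀ + (s : ZMod L)) U))) (linkMeasure n L N) :=
          fun τ => integrable_weightW_mul β hWm hWb ((measurable_legFactor' v t₀ p p' s hAm τ).mul
            ((measurable_slabAvgW v _ β hWm hWb (measurable_slabFactor' v t₀ p p' s hBm _)).comp
              (measurable_restPart v _))) fun U => by
            rw [norm_mul]
            exact mul_le_mul (norm_legFactor_le' v t₀ p p' s hA τ U)
              (norm_slabAvgW_le v _ β hWm hWb (norm_slabFactor_le' v t₀ p p' s hB _) _) (norm_nonneg _)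
              (Nat.cast_nonneg _)
        rw [e1, e2, integral_finsetSum _ fun τ _ => i1 τ, integral_finsetSum _ fun τ _ => i2 τ]
        exact Finset.sum_congr rfl fun τ _ =>
          integral_weightW_mul_mul_eq_slabAvgW v (t₀ + (s : ZMod L)) β hWm hWb (legFactor v t₀ p p' s A τ)
            (slabFactor v t₀ p p' s B (τ.2.1, τ.2.2)) (measurable_legFactor' v t₀ p p' s hAm τ)
            (measurable_slabFactor' v t₀ p p' s hBm _) N _ (norm_legFactor_le' v t₀ p p' s hA τ)
            (norm_slabFactor_le' v t₀ p p' s hB _) (hGslab τ)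
      -- Step 2: the new `B` is measurable, smaller by `N² ε`, and sees only heights `≥ t₀ + s + 1 - m`
      have hB'm : ∀ a b, Measurable fun U => peelBW v t₀ p p' s β W B U a b := fun a b => by
        simp only [peelBW_apply]
        exact (measurable_slabAvgW v _ β hWm hWb (measurable_slabFactor' v t₀ p p' s hBm (a, b))).comp
          (measurable_restPart v _)
      have hB'b : ∀ U a b, ‖peelBW v t₀ p p' s β W B U a b‖ ≤ (N : ℝ) ^ 2 * ε * K := by
        intro U b c
        rw [peelBW_apply, slabAvgW]
        set r := restPart v (t₀ + (s : ZMod L)) U with hr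
        set B₀ := B (glue v (t₀ + (s : ZMod L)) (fun _ => 1) r) with hB₀
        have hint : ∀ Q, slabFactor v t₀ p p' s B (b, c) (glue v (t₀ + (s : ZMod L)) Q r) =
            ∑ κ : Fin N × Fin N, B₀ κ.1 κ.2 * (((Q p : SU N) : Matrix (Fin N) (Fin N) ℂ) b κ.1 *
              (((Q p')⁻¹ : SU N) : Matrix (Fin N) (Fin N) ℂ) κ.2 c) := by
          intro Q
          rw [slabFactor, vlink_glue', vlink_glue', hBc Q, ← coe_inv_SU']
          simp only [Matrix.mul_apply, Finset.sum_mul, Fintype.sum_prod_type]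
          rw [Finset.sum_comm]
          exact Finset.sum_congr rfl fun κ₁ _ => Finset.sum_congr rfl fun κ₂ _ => by ring
        simp_rw [hint]
        haveI := isProbabilityMeasure_slabLawW (n := n) (L := L) (N := N) v (t₀ + (s : ZMod L)) β hWm hWb r
        rw [integral_finsetSum _ fun κ _ => ?_]
        · calc ‖∑ κ : Fin N × Fin N, ∫ Q, B₀ κ.1 κ.2 * (((Q p : SU N) : Matrix (Fin N) (Fin N) ℂ) b κ.1 *
                (((Q p')⁻¹ : SU N) : Matrix (Fin N) (Fin N) ℂ) κ.2 c) ∂(slabLawW v (t₀ + (s : ZMod L)) β W r)‖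
              ≤ ∑ κ : Fin N × Fin N, ‖∫ Q, B₀ κ.1 κ.2 * (((Q p : SU N) : Matrix (Fin N) (Fin N) ℂ) b κ.1 *
                (((Q p')⁻¹ : SU N) : Matrix (Fin N) (Fin N) ℂ) κ.2 c) ∂(slabLawW v (t₀ + (s : ZMod L)) β W r)‖ :=
                norm_sum_le _ _
            _ ≤ ∑ _κ : Fin N × Fin N, K * ε := Finset.sum_le_sum fun κ _ => by
                rw [integral_const_mul, norm_mul]
                exact mul_le_mul (hB _ _ _) (hε _ r b κ.1 κ.2 c) (norm_nonneg _) hK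
            _ = (N : ℝ) ^ 2 * ε * K := by simp; ring
        · refine Integrable.of_bound ?_ (K * (1 * 1)) (ae_of_all _ fun Q => ?_)
          · exact (measurable_const.mul ((measurable_entry p b κ.1).mul
              (measurable_inv_entry p' κ.2 c))).aestronglyMeasurable
          · rw [norm_mul, norm_mul]
            exact mul_le_mul (hB _ _ _) (mul_le_mul (norm_entry_le _ _ _) (norm_entry_le _ _ _) (norm_nonneg _)
              zero_le_one) (by positivity) hK
      have hB's : SeesOnlyAbove v t₀ (s - (m - 1)) (peelBW v t₀ p p' s β W B) := by
        intro U U' hUU'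
        ext b c
        rw [peelBW_apply, peelBW_apply, slabAvgW, slabAvgW]
        -- (i) the two rests agree on the window of range `m` around the slab, so the slab laws agree
        have hwin : ∀ e : {e : Edge (n + 1) L // ¬ IsSlab v (t₀ + (s : ZMod L)) e},
            InWindow v (t₀ + (s : ZMod L)) m e.1 →
              restPart v (t₀ + (s : ZMod L)) U e = restPart v (t₀ + (s : ZMod L)) U' e := by
          intro e hwe
          refine hUU' e.1 ?_
          rintro ⟨k, hk, hkv, hke⟩
          rcases hwe with hne | ⟨k', hk', hh | hh⟩
          · exact hne hkv
          · -- height `t₀ + s + k'` equals a protected height `t₀ + k`, `k < s - (m-1)`: impossible (no wrap, `2(s+1) ≤ L`)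
            rw [hke, add_assoc, ← Nat.cast_add] at hh
            have h1 := Literature.MathematicalPhysics.QuantumLattice.nat_eq_of_zmod_cast_eq (by omega) (by omega) (add_left_cancel hh)
            omega
          · -- height `t₀ + s - k'` equals `t₀ + k`: then `k + k' = s`, impossible
            rw [hke, add_assoc, ← Nat.cast_add] at hh
            have h1 := Literature.MathematicalPhysics.QuantumLattice.nat_eq_of_zmod_cast_eq (by omega) hsL (add_left_cancel hh)
            omega
        have hlaw : slabLawW v (t₀ + (s : ZMod L)) β W (restPart v (t₀ + (s : ZMod L)) U) =
            slabLawW v (t₀ + (s : ZMod L)) β W (restPart v (t₀ + (s : ZMod L)) U') :=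
          slabLawW_eq_of_window v hloc _ β _ _ hwin
        rw [hlaw]
        -- (ii) the integrands agree: `B` sees only heights `≥ t₀ + s + 1`, where `U = U'` off the protected links
        refine integral_congr_ae (ae_of_all _ fun Q => ?_)
        have hBQ : B (glue v (t₀ + (s : ZMod L)) Q (restPart v (t₀ + (s : ZMod L)) U)) =
            B (glue v (t₀ + (s : ZMod L)) Q (restPart v (t₀ + (s : ZMod L)) U')) := by
          refine hBs _ _ fun e he => ?_
          by_cases hse : IsSlab v (t₀ + (s : ZMod L)) e
          · rw [glue_of_isSlab _ _ _ _ hse, glue_of_isSlab _ _ _ _ hse]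
          · rw [glue_of_not_isSlab _ _ _ _ hse, glue_of_not_isSlab _ _ _ _ hse]
            refine hUU' e ?_
            rintro ⟨k, hk, hke⟩
            exact he ⟨k, by omega, hke⟩
        simp only [slabFactor, vlink_glue', hBQ]
      -- Step 3: the induction hypothesis, with counter `m - 1`
      rw [hstep]
      have hs' : s - (m - 1) = s - (m - 1) := rfl
      calc _ ≤ (N : ℝ) ^ 2 * ((N : ℝ) ^ 2 * ε * K) * peelBound N m ε (m - 1) s *
            ∫ U, weightW N β W U ∂(linkMeasure n L N) :=
            ih h2s' (m - 1) (by omega) _ (by positivity) A _ hAm hB'm hA hB'b hAh hB's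
        _ = (N : ℝ) ^ 2 * K * peelBound N m ε 0 (s + 1) * ∫ U, weightW N β W U ∂(linkMeasure n L N) := by
            rw [peelBound]; ring

end Peeling
end Summit.Ventures.YMGap.RobustBall
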